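import Summits.NavierStokesRegularity.NavierStokesRegularity.Theorems.EfficiencyFloorNearSaturationNearMaximiserSeqCoreCurlLimit
import Literature.Analysis.FluidPDE.NSSerrinEstimates
import HarnessLib

/-!
# Route `EfficiencyFloor`, crux `NearSaturationNearMaximiser` (stmt-NavierStokesRegularity-25482) on the
# `ProductionEfficiencyDecay` ladder (stmt-22866): the weak-class limit profile EXISTS

Def-free helper file, twenty-third of the group. The by-name residue (I') of `nearSaturationNearMaximiser_of_gradientProfile`
(`…SeqCoreCurlLimit`) asks for an ADMISSIBLE field `w` whose gradient is the weak `L²`-limit `(M_j)` of the velocity gradients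
`∂ⱼ v_{φ₀k}` of a centred normalised maximising subsequence. This file proves the EXISTENCE half unconditionally, in the weak
class: along any admissible sequence with `Z ≤ 1` whose gradients converge weakly in `L²` to `(M_j)`,

* `memLp_weight_three`, `eLpNorm_weight_smul_le`, `memLp_weight_smul_of_admissible` — the weight `ρ = (1+|x|)^{-3/2} ∈ L³(ℝ³)`
  and the uniform bound `‖ρ v‖_{L²} ≤ ‖ρ‖_{L³} K` for admissible `v` with `Z(v) ≤ 1` (Hölder `(3,6,2)` + `H¹ ⊂ L⁶` + div–curl);
* `exists_weakLimit_of_eLpNorm_le` — weak `L²` limits along a subsequence under a uniform `eLpNorm` bound;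
* `exists_weakProfile` — there is a measurable `w₀ : ℝ³ → ℝ³` with `ρ w₀ ∈ L²(ℝ³)` (a weight that is NOT square-integrable, so it
  excludes the constants and `w₀` is unique a.e.) and `∫⟪w₀, ∂ⱼψ⟫ = −∫⟪M_j, ψ⟫` for every `C¹` compactly supported `ψ`: the
  distributional gradient of `w₀` is `(M_j)`.

The companion file `…SeqCoreProfileRegularity` turns this into the by-name split (I') = existence (here) + regularity/decay.
HONEST FRAMING: nothing here proves stmt-25482, `LerayFloorGap`, `ProductionEfficiencyDecay` (stmt-22866) or Navier–Stokes
regularity; no summit statement is proved. [folklore]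
-/

-- the problem directory repeats the summit name (`NavierStokesRegularity/NavierStokesRegularity`)
set_option linter.dupNamespace false

noncomputable section

namespace Summit.NavierStokesRegularity.NavierStokesRegularity.Theorems

namespace NearSaturationNearMaximiser

namespace SeqCore

open Set MeasureTheory Filter Topology Function Real
open scoped InnerProductSpace ENNReal NNReal
open Literature.Analysis.FluidPDE
open Magsanop2026Enstrophy (slice_integrable)

/-! ## §1 The weight `(1+|x|)^{-3/2}` and the weighted `L²` bound -/

/-- The weight `ρ(x) = (1 + |x|)^{-3/2}` is continuous. [folklore] -/
theorem continuous_weight : Continuous fun x : EuclideanSpace ℝ (Fin 3) => ((1 : ℝ) + ‖x‖) ^ (-(3 / 2 : ℝ)) :=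
  (continuous_const.add continuous_norm).rpow_const fun x => Or.inl (by positivity : (0 : ℝ) < 1 + ‖x‖).ne'

/-- The weight is positive. [folklore] -/
theorem weight_pos (x : EuclideanSpace ℝ (Fin 3)) : 0 < ((1 : ℝ) + ‖x‖) ^ (-(3 / 2 : ℝ)) :=
  Real.rpow_pos_of_pos (by positivity) _

/-- The weight `(1 + |x|)^{-3/2}` lies in `L³(ℝ³)` (`(1+|x|)^{-9/2}` is integrable, `9/2 > 3`). [folklore] -/
theorem memLp_weight_three : MemLp (fun x : EuclideanSpace ℝ (Fin 3) => ((1 : ℝ) + ‖x‖) ^ (-(3 / 2 : ℝ))) 3 volume := by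
  have hint : Integrable (fun x : EuclideanSpace ℝ (Fin 3) => ((1 : ℝ) + ‖x‖) ^ (-(9 / 2 : ℝ))) volume :=
    integrable_one_add_norm (by rw [finrank_euclideanSpace_fin]; norm_num)
  rw [← integrable_norm_rpow_iff continuous_weight.aestronglyMeasurable (by norm_num) (by norm_num)]
  refine hint.congr (ae_of_all _ fun x => ?_)
  have h0 : (0 : ℝ) ≤ 1 + ‖x‖ := by positivity
  simp only [ENNReal.toReal_ofNat]
  rw [Real.norm_eq_abs, abs_of_pos (weight_pos x), ← Real.rpow_mul h0]
  norm_num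

/-- **Weighted `L²` bound from `H¹ ⊂ L⁶`.** For a `C¹` field `v ∈ L²(ℝ³)`:
`‖(1+|x|)^{-3/2} v‖_{L²} ≤ ‖(1+|x|)^{-3/2}‖_{L³} · K · ‖Dv‖_{L²}` (Hölder `(3,6,2)` and the Sobolev inequality). [folklore] -/
theorem eLpNorm_weight_smul_le {v : EuclideanSpace ℝ (Fin 3) → EuclideanSpace ℝ (Fin 3)} (hv : ContDiff ℝ 1 v)
    (hv2 : eLpNorm v 2 volume < ⊤) :
    eLpNorm (fun x => ((1 : ℝ) + ‖x‖) ^ (-(3 / 2 : ℝ)) • v x) 2 volume ≤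
      eLpNorm (fun x : EuclideanSpace ℝ (Fin 3) => ((1 : ℝ) + ‖x‖) ^ (-(3 / 2 : ℝ))) 3 volume *
        ((SNormLESNormFDerivOfEqConst (EuclideanSpace ℝ (Fin 3)) (volume : Measure (EuclideanSpace ℝ (Fin 3))) 2 : ℝ≥0∞) *
          eLpNorm (fderiv ℝ v) 2 volume) := by
  haveI := Literature.Analysis.FluidPDE.holderTriple_three_six_two
  have h1 : eLpNorm ((fun x : EuclideanSpace ℝ (Fin 3) => ((1 : ℝ) + ‖x‖) ^ (-(3 / 2 : ℝ))) • v) 2 volume ≤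
      eLpNorm (fun x : EuclideanSpace ℝ (Fin 3) => ((1 : ℝ) + ‖x‖) ^ (-(3 / 2 : ℝ))) 3 volume * eLpNorm v 6 volume :=
    eLpNorm_smul_le_mul_eLpNorm (p := 3) (q := 6) (r := 2) hv.continuous.aestronglyMeasurable
      continuous_weight.aestronglyMeasurable
  have e : ((fun x : EuclideanSpace ℝ (Fin 3) => ((1 : ℝ) + ‖x‖) ^ (-(3 / 2 : ℝ))) • v) =
      fun x => ((1 : ℝ) + ‖x‖) ^ (-(3 / 2 : ℝ)) • v x := rfl
  rw [e] at h1
  exact h1.trans (mul_le_mul' le_rfl (eLpNorm_six_le_eLpNorm_fderiv_two volume finrank_euclideanSpace_fin hv hv2))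


/-- **Uniform weighted `L²` bound along an admissible sequence with `Z ≤ 1`.** For admissible `v` (smooth, divergence free,
`D⁰, D¹, D² ∈ L²`) with `∫‖curl v‖² ≤ 1`: `(1+|x|)^{-3/2} v ∈ L²` with
`‖(1+|x|)^{-3/2} v‖_{L²} ≤ ‖(1+|x|)^{-3/2}‖_{L³} · K` (`‖Dv‖_{L²} ≤ √Z ≤ 1` by the div–curl identity). [folklore] -/
theorem memLp_weight_smul_of_admissible {v : EuclideanSpace ℝ (Fin 3) → EuclideanSpace ℝ (Fin 3)}
    (hv : ContDiff ℝ (⊤ : ℕ∞) v ∧ VectorCalculus.IsDivFree v ∧ (∫⁻ x, ‖iteratedFDeriv ℝ 0 v x‖ₑ ^ 2 < ⊤) ∧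
      (∫⁻ x, ‖iteratedFDeriv ℝ 1 v x‖ₑ ^ 2 < ⊤) ∧ (∫⁻ x, ‖iteratedFDeriv ℝ 2 v x‖ₑ ^ 2 < ⊤))
    (hZ : ∫ x, ‖curl v x‖ ^ 2 ≤ 1) :
    MemLp (fun x => ((1 : ℝ) + ‖x‖) ^ (-(3 / 2 : ℝ)) • v x) 2 volume ∧
      eLpNorm (fun x => ((1 : ℝ) + ‖x‖) ^ (-(3 / 2 : ℝ)) • v x) 2 volume ≤
        eLpNorm (fun x : EuclideanSpace ℝ (Fin 3) => ((1 : ℝ) + ‖x‖) ^ (-(3 / 2 : ℝ))) 3 volume *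
          (SNormLESNormFDerivOfEqConst (EuclideanSpace ℝ (Fin 3)) (volume : Measure (EuclideanSpace ℝ (Fin 3))) 2 : ℝ≥0∞) := by
  obtain ⟨hcd, hdiv, h0, h1, h2⟩ := hv
  have hc1 : ContDiff ℝ 1 v := hcd.of_le (by norm_cast)
  -- `v ∈ L²`
  have h0' : ∫⁻ x, ‖v x‖ₑ ^ (2 : ℝ) < ⊤ := by
    refine lt_of_le_of_lt (le_of_eq (lintegral_congr fun x => ?_)) h0
    rw [← ofReal_norm, ← norm_iteratedFDeriv_zero (𝕜 := ℝ) (f := v), ofReal_norm, ENNReal.rpow_two]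
  have hu2 : eLpNorm v 2 volume < ⊤ := by
    rw [eLpNorm_lt_top_iff_lintegral_rpow_enorm_lt_top two_ne_zero ENNReal.ofNat_ne_top, ENNReal.toReal_ofNat]
    exact h0'
  -- `‖Dv‖_{L²} ≤ 1`
  have hv3 : ContDiff ℝ 3 v := hcd.of_le (by norm_cast)
  obtain ⟨-, -, -, -, -, IDv, -⟩ := slice_integrable hv3 h1 h2
  have hDc : Continuous (fderiv ℝ v) := hc1.continuous_fderiv one_ne_zero
  have hmD : MemLp (fderiv ℝ v) 2 volume := (memLp_two_iff_integrable_sq_norm hDc.aestronglyMeasurable).2 IDv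
  have hD1 : eLpNorm (fderiv ℝ v) 2 volume ≤ 1 := by
    rw [hmD.eLpNorm_eq_integral_rpow_norm two_ne_zero ENNReal.ofNat_ne_top, ENNReal.toReal_ofNat]
    refine ENNReal.ofReal_le_one.2 ?_
    have hle : ∫ x, ‖fderiv ℝ v x‖ ^ (2 : ℝ) ≤ 1 := by
      have h := (integral_norm_fderiv_sq_le_enstrophy ⟨hcd, hdiv, h0, h1, h2⟩).trans hZ
      refine le_trans (le_of_eq (integral_congr_ae (ae_of_all _ fun x => ?_))) h
      simp only [Real.rpow_two]
    calc (∫ x, ‖fderiv ℝ v x‖ ^ (2 : ℝ)) ^ ((2 : ℝ)⁻¹) ≤ 1 ^ ((2 : ℝ)⁻¹) :=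
        Real.rpow_le_rpow (integral_nonneg fun x => by positivity) hle (by norm_num)
      _ = 1 := Real.one_rpow _
  have hle := eLpNorm_weight_smul_le hc1 hu2
  have hle' : eLpNorm (fun x => ((1 : ℝ) + ‖x‖) ^ (-(3 / 2 : ℝ)) • v x) 2 volume ≤
      eLpNorm (fun x : EuclideanSpace ℝ (Fin 3) => ((1 : ℝ) + ‖x‖) ^ (-(3 / 2 : ℝ))) 3 volume *
        (SNormLESNormFDerivOfEqConst (EuclideanSpace ℝ (Fin 3)) (volume : Measure (EuclideanSpace ℝ (Fin 3))) 2 : ℝ≥0∞) := by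
    refine hle.trans (mul_le_mul' le_rfl ?_)
    calc (SNormLESNormFDerivOfEqConst (EuclideanSpace ℝ (Fin 3)) (volume : Measure (EuclideanSpace ℝ (Fin 3))) 2 : ℝ≥0∞) *
        eLpNorm (fderiv ℝ v) 2 volume ≤ (SNormLESNormFDerivOfEqConst (EuclideanSpace ℝ (Fin 3))
          (volume : Measure (EuclideanSpace ℝ (Fin 3))) 2 : ℝ≥0∞) * 1 := mul_le_mul' le_rfl hD1
      _ = _ := mul_one _
  have htop : eLpNorm (fun x : EuclideanSpace ℝ (Fin 3) => ((1 : ℝ) + ‖x‖) ^ (-(3 / 2 : ℝ))) 3 volume *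
      (SNormLESNormFDerivOfEqConst (EuclideanSpace ℝ (Fin 3)) (volume : Measure (EuclideanSpace ℝ (Fin 3))) 2 : ℝ≥0∞) < ⊤ :=
    (ENNReal.mul_ne_top memLp_weight_three.eLpNorm_ne_top ENNReal.coe_ne_top).lt_top
  exact ⟨⟨(continuous_weight.smul hcd.continuous).aestronglyMeasurable, hle'.trans_lt htop⟩, hle'⟩

/-! ## §2 Weak limits in `L²` under a uniform `eLpNorm` bound -/

/-- **Weak limits in `L²` as functions**, `eLpNorm` form: if `f_k ∈ L²(ℝ³; ℝ³)` with `‖f_k‖_{L²} ≤ B < ∞`, there are `G ∈ L²` and a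
strictly increasing `φ` with `∫⟪f_{φ k}, ψ⟫ → ∫⟪G, ψ⟫` for every `ψ ∈ L²` (sequential Banach–Alaoglu, `exists_subseq_weak_limit`).
[folklore] -/
theorem exists_weakLimit_of_eLpNorm_le {f : ℕ → EuclideanSpace ℝ (Fin 3) → EuclideanSpace ℝ (Fin 3)}
    (hf : ∀ k, MemLp (f k) 2 volume) {B : ℝ≥0∞} (hB : B ≠ ⊤) (hle : ∀ k, eLpNorm (f k) 2 volume ≤ B) :
    ∃ G : EuclideanSpace ℝ (Fin 3) → EuclideanSpace ℝ (Fin 3), MemLp G 2 volume ∧ ∃ φ : ℕ → ℕ, StrictMono φ ∧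
      ∀ ψ : EuclideanSpace ℝ (Fin 3) → EuclideanSpace ℝ (Fin 3), MemLp ψ 2 volume →
        Tendsto (fun k => ∫ x, ⟪f (φ k) x, ψ x⟫_ℝ) atTop (𝓝 (∫ x, ⟪G x, ψ x⟫_ℝ)) := by
  haveI : Fact ((2 : ℝ≥0∞) ≠ ∞) := ⟨ENNReal.ofNat_ne_top⟩
  have hxn : ∀ k, ‖(hf k).toLp (f k)‖ ≤ B.toReal := fun k => by
    rw [Lp.norm_toLp]
    exact ENNReal.toReal_mono hB (hle k)
  obtain ⟨y, φ, hφ, hlim⟩ := exists_subseq_weak_limit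
    (H := Lp (EuclideanSpace ℝ (Fin 3)) 2 (volume : Measure (EuclideanSpace ℝ (Fin 3)))) (x := fun k => (hf k).toLp (f k)) hxn
  refine ⟨y, Lp.memLp y, φ, hφ, fun ψ hψ => ?_⟩
  have h := hlim (hψ.toLp ψ)
  have e1 : ∀ k, ⟪(hf (φ k)).toLp (f (φ k)), hψ.toLp ψ⟫_ℝ = ∫ a, ⟪f (φ k) a, ψ a⟫_ℝ := fun k => by
    rw [MeasureTheory.L2.inner_def]
    exact integral_congr_ae (((hf (φ k)).coeFn_toLp).mp ((hψ.coeFn_toLp).mono fun a ha hb => by simp only [ha, hb]))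
  have e2 : ⟪y, hψ.toLp ψ⟫_ℝ = ∫ a, ⟪y a, ψ a⟫_ℝ := by
    rw [MeasureTheory.L2.inner_def]
    exact integral_congr_ae ((hψ.coeFn_toLp).mono fun a ha => by simp only [ha])
  rw [e2] at h
  exact h.congr e1

/-! ## §3 EXISTENCE of the weak-class limit profile -/

/-- **The weak-class limit profile exists.** Along admissible `u_k` with `Z(u_k) ≤ 1`, if the velocity gradients converge weakly
in `L²`, `∂ⱼu_k ⇀ M_j` (against all `L²` fields), then there is a measurable `w₀ : ℝ³ → ℝ³` with `(1+|x|)^{-3/2} w₀ ∈ L²(ℝ³)` and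
`∫⟪w₀, ∂ⱼψ⟫ = −∫⟪M_j, ψ⟫` for all `C¹` compactly supported `ψ` and `j = 1,2,3`: the distributional gradient of `w₀` is `(M_j)`.
Construction: a weak `L²`-limit `G` of the uniformly bounded `(1+|x|)^{-3/2} u_{φ k}` (`memLp_weight_smul_of_admissible`,
`exists_weakLimit_of_eLpNorm_le`), `w₀ = (1+|x|)^{3/2} G`; the identity is the limit of `∫⟪u_{φk}, ∂ⱼψ⟫ = −∫⟪∂ⱼu_{φk}, ψ⟫`.
The weight is not square-integrable, so `w₀` is unique a.e. (no free additive constant). [folklore] -/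
theorem exists_weakProfile {u : ℕ → EuclideanSpace ℝ (Fin 3) → EuclideanSpace ℝ (Fin 3)}
    (hu : ∀ k, ContDiff ℝ (⊤ : ℕ∞) (u k) ∧ VectorCalculus.IsDivFree (u k) ∧ (∫⁻ x, ‖iteratedFDeriv ℝ 0 (u k) x‖ₑ ^ 2 < ⊤) ∧
      (∫⁻ x, ‖iteratedFDeriv ℝ 1 (u k) x‖ₑ ^ 2 < ⊤) ∧ (∫⁻ x, ‖iteratedFDeriv ℝ 2 (u k) x‖ₑ ^ 2 < ⊤))
    (hZ : ∀ k, ∫ x, ‖curl (u k) x‖ ^ 2 ≤ 1)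
    {M : Fin 3 → EuclideanSpace ℝ (Fin 3) → EuclideanSpace ℝ (Fin 3)}
    (hconv : ∀ (j : Fin 3) (ψ : EuclideanSpace ℝ (Fin 3) → EuclideanSpace ℝ (Fin 3)), MemLp ψ 2 volume →
      Tendsto (fun k => ∫ x, ⟪fderiv ℝ (u k) x (EuclideanSpace.basisFun (Fin 3) ℝ j), ψ x⟫_ℝ) atTop (𝓝 (∫ x, ⟪M j x, ψ x⟫_ℝ))) :
    ∃ w₀ : EuclideanSpace ℝ (Fin 3) → EuclideanSpace ℝ (Fin 3), AEStronglyMeasurable w₀ volume ∧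
      MemLp (fun x => ((1 : ℝ) + ‖x‖) ^ (-(3 / 2 : ℝ)) • w₀ x) 2 volume ∧
      ∀ (j : Fin 3) (ψ : EuclideanSpace ℝ (Fin 3) → EuclideanSpace ℝ (Fin 3)), ContDiff ℝ 1 ψ → HasCompactSupport ψ →
        ∫ x, ⟪w₀ x, fderiv ℝ ψ x (EuclideanSpace.basisFun (Fin 3) ℝ j)⟫_ℝ = -∫ x, ⟪M j x, ψ x⟫_ℝ := by
  set ρ : EuclideanSpace ℝ (Fin 3) → ℝ := fun x => ((1 : ℝ) + ‖x‖) ^ (-(3 / 2 : ℝ)) with hρ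
  have hρpos : ∀ x, 0 < ρ x := fun x => weight_pos x
  have hρc : Continuous ρ := continuous_weight
  have hρic : Continuous fun x => (ρ x)⁻¹ := hρc.inv₀ fun x => (hρpos x).ne'
  -- the weighted fields and their weak limit
  have hg := fun k => memLp_weight_smul_of_admissible (hu k) (hZ k)
  obtain ⟨G, hG, φ, hφ, hlim⟩ := exists_weakLimit_of_eLpNorm_le (f := fun k x => ρ x • u k x) (fun k => (hg k).1)
    (ENNReal.mul_ne_top memLp_weight_three.eLpNorm_ne_top ENNReal.coe_ne_top) (fun k => (hg k).2)
  refine ⟨fun x => (ρ x)⁻¹ • G x, hρic.aestronglyMeasurable.smul hG.1, ?_, fun j ψ hψ hψc => ?_⟩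
  · have e : (fun x => ρ x • (ρ x)⁻¹ • G x) = G := funext fun x => by
      rw [smul_smul, mul_inv_cancel₀ (hρpos x).ne', one_smul]
    show MemLp (fun x => ρ x • (ρ x)⁻¹ • G x) 2 volume
    rw [e]; exact hG
  · set e : EuclideanSpace ℝ (Fin 3) := EuclideanSpace.basisFun (Fin 3) ℝ j with he
    have hDψc : Continuous fun x => fderiv ℝ ψ x e := (hψ.continuous_fderiv one_ne_zero).clm_apply continuous_const
    have hDψcs : HasCompactSupport fun x => fderiv ℝ ψ x e := hψc.fderiv_apply (𝕜 := ℝ) e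
    -- the test field `ρ⁻¹ ∂ⱼψ ∈ L²`
    have hζc : Continuous fun x => (ρ x)⁻¹ • fderiv ℝ ψ x e := hρic.smul hDψc
    have hζcs : HasCompactSupport fun x => (ρ x)⁻¹ • fderiv ℝ ψ x e := by
      have h : HasCompactSupport ((fun x => (ρ x)⁻¹) • fun x => fderiv ℝ ψ x e) := hDψcs.smul_left
      exact h
    have hζ2 : MemLp (fun x => (ρ x)⁻¹ • fderiv ℝ ψ x e) 2 volume := hζc.memLp_of_hasCompactSupport hζcs
    have hψ2 : MemLp ψ 2 volume := hψ.continuous.memLp_of_hasCompactSupport hψc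
    -- limit 1: `∫⟪u_{φk}, ∂ⱼψ⟫ → ∫⟪w₀, ∂ⱼψ⟫`
    have T1 : Tendsto (fun k => ∫ x, ⟪u (φ k) x, fderiv ℝ ψ x e⟫_ℝ) atTop (𝓝 (∫ x, ⟪(ρ x)⁻¹ • G x, fderiv ℝ ψ x e⟫_ℝ)) := by
      have h := hlim _ hζ2
      have e1 : ∀ k, (∫ x, ⟪ρ x • u (φ k) x, (ρ x)⁻¹ • fderiv ℝ ψ x e⟫_ℝ) = ∫ x, ⟪u (φ k) x, fderiv ℝ ψ x e⟫_ℝ := fun k =>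
        integral_congr_ae (ae_of_all _ fun x => by
          show ⟪ρ x • u (φ k) x, (ρ x)⁻¹ • fderiv ℝ ψ x e⟫_ℝ = ⟪u (φ k) x, fderiv ℝ ψ x e⟫_ℝ
          rw [real_inner_smul_left, real_inner_smul_right, ← mul_assoc, mul_inv_cancel₀ (hρpos x).ne', one_mul])
      have e2 : (∫ x, ⟪G x, (ρ x)⁻¹ • fderiv ℝ ψ x e⟫_ℝ) = ∫ x, ⟪(ρ x)⁻¹ • G x, fderiv ℝ ψ x e⟫_ℝ :=
        integral_congr_ae (ae_of_all _ fun x => by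
          show ⟪G x, (ρ x)⁻¹ • fderiv ℝ ψ x e⟫_ℝ = ⟪(ρ x)⁻¹ • G x, fderiv ℝ ψ x e⟫_ℝ
          rw [real_inner_smul_left, real_inner_smul_right])
      rw [e2] at h
      exact h.congr e1
    -- limit 2: integration by parts and the weak convergence of `∂ⱼu_{φk}`
    have T2 : Tendsto (fun k => ∫ x, ⟪u (φ k) x, fderiv ℝ ψ x e⟫_ℝ) atTop (𝓝 (-∫ x, ⟪M j x, ψ x⟫_ℝ)) := by
      have h := ((hconv j ψ hψ2).comp hφ.tendsto_atTop).neg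
      refine h.congr fun k => ?_
      have hc1 : ContDiff ℝ 1 (u (φ k)) := (hu (φ k)).1.of_le (by norm_cast)
      show -(∫ x, ⟪fderiv ℝ (u (φ k)) x e, ψ x⟫_ℝ) = ∫ x, ⟪u (φ k) x, fderiv ℝ ψ x e⟫_ℝ
      rw [integral_inner_fderiv_apply_const_eq_neg hc1 hψ hψc e, neg_neg]
    exact tendsto_nhds_unique T1 T2


end SeqCore

end NearSaturationNearMaximiser

end Summit.NavierStokesRegularity.NavierStokesRegularity.Theorems

end
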